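import Summits.Ventures.LatticeQCDFlow.Exactness.IMHGrandCoupling
import HarnessLib

/-!
# The grand coupling, exactly: after `n` shared updates ANY family of runs IS, with probability `1 − rⁿ`, one
# `π`-distributed configuration recorded once per run — all runs have merged except with probability `rⁿ`,
# independently of their number

HONEST FRAMING: exact (Metropolis-corrected) sampling algorithms for lattice gauge theory;
figures of merit are autocorrelation/cost numbers at stated couplings and volumes; no
continuum-physics claim.

Venture `LatticeQCDFlow` (cell pub-lqcd), topic `Exactness`; FANOUT row 30 (lean-1, GEN-36).  NEW WORK of the
cell, general state space.  `Exactness/IMHGrandCoupling` (this generation) built the common-random-numbers kernel `K̂`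
of an arbitrary family `(x_i)_{i ∈ ι}` of runs of `K = indepMH q w` (`A = 1/w(x₀)`, `r = 1 − A`) and its minorisation
by the CONSTANT LIFT `π̂ = π∘(y ↦ (i ↦ y))⁻¹` with the exact constant `A`, uniformly in `ι`.  As for pairs
(`Exactness/IMHCommonRandomNumbersSplit`), Doeblin's split runs on the family chain:

* §1 **`crnFamily_apply_eq_constLift_of_mode_eq_one`** — `w(x₀) = 1 ⇒ K̂(z, ·) = π̂`;
  **`iterate_bind_crnFamily_eq_residual_mixture`** — FOR EVERY INITIAL COUPLING `μ̂₀` of the family (any joint law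
  of the starting configurations) and every `n`: `μ̂₀K̂ⁿ = (1 − rⁿ)·π̂ + rⁿ·μ̂₀R̂ⁿ` EXACTLY (`w(x₀) > 1`);
  **`exists_iterate_bind_crnFamily_eq_mixture`** — the `R̂`-free form for `w(x₀) ≥ 1`.
* §2 consequences from every initial coupling: **`iterate_bind_crnFamily_real_ge`** —
  `P(Ẑ_n ∈ C) ≥ (1 − rⁿ)·π{y : (i ↦ y) ∈ C}` for every measurable `C`;
  **`iterate_bind_crnFamily_allEqual_ge`** — for a countable family on a space with measurable diagonal:
  `P(Z_n i = Z_n j for all i, j) ≥ 1 − rⁿ` — ALL RUNS COINCIDE after `n` shared updates except with probability `rⁿ`,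
  WHATEVER THEIR NUMBER (`R` independent runs would need `≈ log R / A` more updates for the same guarantee by a
  union bound; shared random numbers need none); **`iterate_bind_crnFamily_allEqual_ge_of_log_le`** —
  `log(1/δ) ≤ n·A ⇒ ≥ 1 − δ`; **`iterate_bind_crnFamily_observable_allEqual_ge`** — diagonal-free form for a countable
  family: every measurable observable reads the same on all runs with probability `≥ 1 − rⁿ`.
Reading: the stochastic flow of an exact flow sampler driven by shared random numbers forgets EVERY starting
configuration simultaneously at the geometric rate `r`; a practitioner running many chains on one stream of proposals
and uniforms sees them collapse onto one chain after `≈ (1/A)·log(1/δ)` updates.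
NOT CLAIMED: measurability of «all runs coincide» for uncountable families; the law of the merging time beyond its
tail; anything for different targets.  No `sorry`, no new definitions, nothing cited as a fact.
-/

noncomputable section

namespace Summit.Ventures.LatticeQCDFlow.Exactness

open MeasureTheory ProbabilityTheory Function Set
open scoped ENNReal unitInterval
open Literature.Probability.MarkovChains

variable {Ω : Type*} [MeasurableSpace Ω] {q : Measure Ω} [IsProbabilityMeasure q] {w : Ω → ℝ} {ι : Type*}

/-! ## §1 The exact split of the family law -/

omit [IsProbabilityMeasure q] in
/-- When the mode has weight `1` the family kernel IS the constant lift of the target from every family. [ours] -/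
theorem crnFamily_apply_eq_constLift_of_mode_eq_one (hw : Measurable w) (hw0 : ∀ y, 0 < w y) {x₀ : Ω}
    (hmax : ∀ y, w y ≤ w x₀) (h1 : w x₀ = 1) [IsProbabilityMeasure (q.withDensity fun y => ENNReal.ofReal (w y))]
    (Khat : Kernel (ι → Ω) (ι → Ω)) [IsMarkovKernel Khat]
    (hK : ∀ z : ι → Ω, Khat z = (q.prod (volume : Measure unitInterval)).map
      (fun p : Ω × unitInterval => fun i : ι => if (p.2 : ℝ) * w (z i) ≤ w p.1 then p.1 else z i))
    (z : ι → Ω) : Khat z = (q.withDensity fun y => ENNReal.ofReal (w y)).map (fun (y : Ω) (_ : ι) => y) := by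
  set πh : Measure (ι → Ω) := (q.withDensity fun y => ENNReal.ofReal (w y)).map (fun (y : Ω) (_ : ι) => y) with hπh
  haveI : IsProbabilityMeasure πh := isProbabilityMeasure_constLift _
  have hge : ∀ {C : Set (ι → Ω)}, MeasurableSet C → πh C ≤ Khat z C := by
    intro C hC
    have h := crnFamily_minorised hw hw0 hmax Khat hK z hC
    rwa [h1, inv_one, ENNReal.ofReal_one, one_mul] at h
  ext C hC
  refine le_antisymm ?_ (hge hC)
  have hKc : Khat z C = 1 - Khat z Cᶜ := by
    rw [← prob_add_prob_compl (μ := Khat z) hC, ENNReal.add_sub_cancel_right (measure_ne_top _ _)]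
  have hπc : πh C = 1 - πh Cᶜ := by
    rw [← prob_add_prob_compl (μ := πh) hC, ENNReal.add_sub_cancel_right (measure_ne_top _ _)]
  rw [hKc, hπc]
  exact tsub_le_tsub_left (hge hC.compl) 1

/-- **EVERY INITIAL COUPLING OF THE FAMILY, EXACTLY.**  `w` measurable, positive, normalised, maximal at `x₀` with
`w(x₀) > 1`; `K̂` a CRN family kernel (Markov), `R̂` the residual kernel of `K̂ ≥ (1/w(x₀))·π̂`.  For every probability
law `μ̂₀` on `ι → Ω` and every `n`: `μ̂₀K̂ⁿ = (1 − rⁿ)·π̂ + rⁿ·μ̂₀R̂ⁿ`. [ours] -/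
theorem iterate_bind_crnFamily_eq_residual_mixture (hw : Measurable w) (hw0 : ∀ y, 0 < w y) {x₀ : Ω}
    (hmax : ∀ y, w y ≤ w x₀) (hlt : 1 < w x₀)
    [IsProbabilityMeasure (q.withDensity fun y => ENNReal.ofReal (w y))]
    (Khat : Kernel (ι → Ω) (ι → Ω)) [IsMarkovKernel Khat]
    (hK : ∀ z : ι → Ω, Khat z = (q.prod (volume : Measure unitInterval)).map
      (fun p : Ω × unitInterval => fun i : ι => if (p.2 : ℝ) * w (z i) ≤ w p.1 then p.1 else z i))
    (n : ℕ) (μ₀ : Measure (ι → Ω)) [IsProbabilityMeasure μ₀] :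
    (fun m : Measure (ι → Ω) => m.bind Khat)^[n] μ₀ =
      ENNReal.ofReal (1 - (1 - (w x₀)⁻¹) ^ n) •
          (q.withDensity fun y => ENNReal.ofReal (w y)).map (fun (y : Ω) (_ : ι) => y) +
        ENNReal.ofReal ((1 - (w x₀)⁻¹) ^ n) •
          (fun m : Measure (ι → Ω) => m.bind
            (@Doeblin.residualKernel (ι → Ω) _ Khat _ ((q.withDensity fun y => ENNReal.ofReal (w y)).map
              (fun (y : Ω) (_ : ι) => y)) (isProbabilityMeasure_constLift _) (ENNReal.ofReal (w x₀)⁻¹)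
              (crnFamily_minorised hw hw0 hmax Khat hK)))^[n] μ₀ := by
  set π : Measure Ω := q.withDensity fun y => ENNReal.ofReal (w y) with hπ
  haveI hπh : IsProbabilityMeasure (π.map (fun (y : Ω) (_ : ι) => y)) := isProbabilityMeasure_constLift π
  set ε : ℝ≥0∞ := ENNReal.ofReal (w x₀)⁻¹ with hε
  have hε1 : ε < 1 := ofReal_inv_lt_one_of_one_lt hlt
  haveI hRm := @Doeblin.isMarkovKernel_residualKernel (ι → Ω) _ Khat _ (π.map (fun (y : Ω) (_ : ι) => y)) hπh ε
    (crnFamily_minorised hw hw0 hmax Khat hK) hε1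
  set R := @Doeblin.residualKernel (ι → Ω) _ Khat _ (π.map (fun (y : Ω) (_ : ι) => y)) hπh ε
    (crnFamily_minorised hw hw0 hmax Khat hK) with hR
  have ha0 : 0 ≤ (w x₀)⁻¹ := inv_nonneg.mpr (hw0 x₀).le
  have hr0 : 0 ≤ 1 - (w x₀)⁻¹ := sub_nonneg.2 (inv_le_one_of_one_le₀ hlt.le)
  have hr1 : 1 - (w x₀)⁻¹ ≤ 1 := sub_le_self _ ha0
  have hinv : (π.map (fun (y : Ω) (_ : ι) => y)).bind Khat = π.map (fun (y : Ω) (_ : ι) => y) :=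
    bind_constLift_crnFamily hw hw0 Khat hK
  induction n generalizing μ₀ with
  | zero => simp
  | succ n ih =>
    haveI : IsProbabilityMeasure ((fun m : Measure (ι → Ω) => m.bind R)^[n] μ₀) :=
      isProbabilityMeasure_iterate_bind (κ := R) μ₀ n
    rw [Function.iterate_succ_apply', ih μ₀, Summit.Ventures.LatticeQCDFlow.Scoring.bind_add_measure,
      Measure.bind_smul, Measure.bind_smul, hinv,
      Doeblin.bind_eq_add_residual (κ := Khat) (ν := π.map (fun (y : Ω) (_ : ι) => y)) (ε := ε)
        (hmin := crnFamily_minorised hw hw0 hmax Khat hK) hε1 ((fun m : Measure (ι → Ω) => m.bind R)^[n] μ₀),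
      ← Function.iterate_succ_apply' (fun m : Measure (ι → Ω) => m.bind R) n μ₀, smul_add, smul_smul, smul_smul,
      ← add_assoc, ← add_smul, hε, one_sub_ofReal_inv_eq hw0 x₀, ← ENNReal.ofReal_mul (pow_nonneg hr0 n),
      ← ENNReal.ofReal_mul (pow_nonneg hr0 n),
      ← ENNReal.ofReal_add (sub_nonneg.2 (pow_le_one₀ hr0 hr1)) (mul_nonneg (pow_nonneg hr0 n) ha0)]
    congr 3
    all_goals ring

/-- The `R̂`-free form (`w(x₀) ≥ 1`): `μ̂₀K̂ⁿ = (1 − rⁿ)·π̂ + rⁿ·ν̂` for SOME probability law `ν̂` on `ι → Ω`. [ours] -/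
theorem exists_iterate_bind_crnFamily_eq_mixture (hw : Measurable w) (hw0 : ∀ y, 0 < w y) {x₀ : Ω}
    (hmax : ∀ y, w y ≤ w x₀) [IsProbabilityMeasure (q.withDensity fun y => ENNReal.ofReal (w y))]
    (Khat : Kernel (ι → Ω) (ι → Ω)) [IsMarkovKernel Khat]
    (hK : ∀ z : ι → Ω, Khat z = (q.prod (volume : Measure unitInterval)).map
      (fun p : Ω × unitInterval => fun i : ι => if (p.2 : ℝ) * w (z i) ≤ w p.1 then p.1 else z i))
    (n : ℕ) (μ₀ : Measure (ι → Ω)) [IsProbabilityMeasure μ₀] :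
    ∃ ν : Measure (ι → Ω), IsProbabilityMeasure ν ∧
      (fun m : Measure (ι → Ω) => m.bind Khat)^[n] μ₀ =
        ENNReal.ofReal (1 - (1 - (w x₀)⁻¹) ^ n) •
            (q.withDensity fun y => ENNReal.ofReal (w y)).map (fun (y : Ω) (_ : ι) => y) +
          ENNReal.ofReal ((1 - (w x₀)⁻¹) ^ n) • ν := by
  rcases (one_le_of_mode (q := q) hmax).eq_or_lt with h1 | hlt
  · set πh : Measure (ι → Ω) := (q.withDensity fun y => ENNReal.ofReal (w y)).map (fun (y : Ω) (_ : ι) => y)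
      with hπh
    haveI : IsProbabilityMeasure πh := isProbabilityMeasure_constLift _
    refine ⟨if n = 0 then μ₀ else πh, by split_ifs <;> infer_instance, ?_⟩
    rcases n with _ | n
    · simp
    · have hstep : ∀ (m : Measure (ι → Ω)) [IsProbabilityMeasure m], m.bind Khat = πh := by
        intro m _
        ext C hC
        rw [Measure.bind_apply hC (Kernel.aemeasurable _)]
        simp_rw [crnFamily_apply_eq_constLift_of_mode_eq_one hw hw0 hmax h1.symm Khat hK]
        rw [lintegral_const, measure_univ, mul_one]
      haveI := isProbabilityMeasure_iterate_bind (κ := Khat) μ₀ n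
      rw [Function.iterate_succ_apply', hstep, ← h1]
      simp
  · haveI hπh := isProbabilityMeasure_constLift (ι := ι) (q.withDensity fun y => ENNReal.ofReal (w y))
    haveI := @Doeblin.isMarkovKernel_residualKernel (ι → Ω) _ Khat _ _ hπh (ENNReal.ofReal (w x₀)⁻¹)
      (crnFamily_minorised hw hw0 hmax Khat hK) (ofReal_inv_lt_one_of_one_lt hlt)
    exact ⟨_, isProbabilityMeasure_iterate_bind μ₀ n,
      iterate_bind_crnFamily_eq_residual_mixture hw hw0 hmax hlt Khat hK n μ₀⟩

/-! ## §2 Consequences from every initial coupling -/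

/-- **THE LOWER ENVELOPE ON FAMILIES**: `P(Ẑ_n ∈ C) ≥ (1 − rⁿ)·π{y : (i ↦ y) ∈ C}` for every measurable `C` and every
initial coupling of the family. [ours] -/
theorem iterate_bind_crnFamily_real_ge (hw : Measurable w) (hw0 : ∀ y, 0 < w y) {x₀ : Ω} (hmax : ∀ y, w y ≤ w x₀)
    [IsProbabilityMeasure (q.withDensity fun y => ENNReal.ofReal (w y))]
    (Khat : Kernel (ι → Ω) (ι → Ω)) [IsMarkovKernel Khat]
    (hK : ∀ z : ι → Ω, Khat z = (q.prod (volume : Measure unitInterval)).map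
      (fun p : Ω × unitInterval => fun i : ι => if (p.2 : ℝ) * w (z i) ≤ w p.1 then p.1 else z i))
    (n : ℕ) (μ₀ : Measure (ι → Ω)) [IsProbabilityMeasure μ₀] {C : Set (ι → Ω)} (hC : MeasurableSet C) :
    (1 - (1 - (w x₀)⁻¹) ^ n) * ((q.withDensity fun y => ENNReal.ofReal (w y)).real {y | (fun _ : ι => y) ∈ C}) ≤
      ((fun m : Measure (ι → Ω) => m.bind Khat)^[n] μ₀).real C := by
  obtain ⟨ν, hν, h⟩ := exists_iterate_bind_crnFamily_eq_mixture hw hw0 hmax Khat hK n μ₀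
  have hc : Measurable (fun (y : Ω) (_ : ι) => y) := measurable_pi_lambda _ fun _ => measurable_id
  have hW : 1 ≤ w x₀ := one_le_of_mode (q := q) hmax
  have hr0 : 0 ≤ 1 - (w x₀)⁻¹ := sub_nonneg.2 (inv_le_one_of_one_le₀ hW)
  have hr1 : 1 - (w x₀)⁻¹ ≤ 1 := sub_le_self _ (inv_nonneg.mpr (hw0 x₀).le)
  have hc0 : 0 ≤ 1 - (1 - (w x₀)⁻¹) ^ n := sub_nonneg.2 (pow_le_one₀ hr0 hr1)
  rw [h]
  simp only [measureReal_def, Measure.add_apply, Measure.smul_apply, smul_eq_mul, Measure.map_apply hc hC]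
  rw [ENNReal.toReal_add (ENNReal.mul_ne_top ENNReal.ofReal_ne_top (measure_ne_top _ _))
      (ENNReal.mul_ne_top ENNReal.ofReal_ne_top (measure_ne_top _ _)), ENNReal.toReal_mul,
    ENNReal.toReal_ofReal hc0]
  exact le_add_of_nonneg_right ENNReal.toReal_nonneg

/-- **ALL RUNS COINCIDE EXCEPT WITH PROBABILITY `rⁿ`, WHATEVER THEIR NUMBER** (countable family, measurable diagonal):
`P(Z_n i = Z_n j for all i, j) ≥ 1 − rⁿ` after `n` shared updates, from every initial coupling. [ours] -/
theorem iterate_bind_crnFamily_allEqual_ge [Countable ι] [MeasurableEq Ω] (hw : Measurable w) (hw0 : ∀ y, 0 < w y)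
    {x₀ : Ω} (hmax : ∀ y, w y ≤ w x₀) [IsProbabilityMeasure (q.withDensity fun y => ENNReal.ofReal (w y))]
    (Khat : Kernel (ι → Ω) (ι → Ω)) [IsMarkovKernel Khat]
    (hK : ∀ z : ι → Ω, Khat z = (q.prod (volume : Measure unitInterval)).map
      (fun p : Ω × unitInterval => fun i : ι => if (p.2 : ℝ) * w (z i) ≤ w p.1 then p.1 else z i))
    (n : ℕ) (μ₀ : Measure (ι → Ω)) [IsProbabilityMeasure μ₀] :
    1 - (1 - (w x₀)⁻¹) ^ n ≤ ((fun m : Measure (ι → Ω) => m.bind Khat)^[n] μ₀).real {z | ∀ i j, z i = z j} := by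
  have hC : MeasurableSet {z : ι → Ω | ∀ i j, z i = z j} := by
    have : {z : ι → Ω | ∀ i j, z i = z j} = ⋂ i, ⋂ j, {z : ι → Ω | z i = z j} := by
      ext z; simp
    rw [this]
    exact MeasurableSet.iInter fun i => MeasurableSet.iInter fun j =>
      measurableSet_eq_fun (measurable_pi_apply i) (measurable_pi_apply j)
  have h := iterate_bind_crnFamily_real_ge hw hw0 hmax Khat hK n μ₀ hC
  have hset : {y : Ω | (fun _ : ι => y) ∈ {z : ι → Ω | ∀ i j, z i = z j}} = univ := by
    ext y; simp
  rwa [hset, probReal_univ, mul_one] at h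

/-- **`log(1/δ) ≤ n·A` SHARED UPDATES MERGE THE WHOLE FAMILY WITH PROBABILITY `≥ 1 − δ`** (countable family,
measurable diagonal) — the number of runs does not enter. [ours] -/
theorem iterate_bind_crnFamily_allEqual_ge_of_log_le [Countable ι] [MeasurableEq Ω] (hw : Measurable w)
    (hw0 : ∀ y, 0 < w y) {x₀ : Ω} (hmax : ∀ y, w y ≤ w x₀)
    [IsProbabilityMeasure (q.withDensity fun y => ENNReal.ofReal (w y))]
    (Khat : Kernel (ι → Ω) (ι → Ω)) [IsMarkovKernel Khat]
    (hK : ∀ z : ι → Ω, Khat z = (q.prod (volume : Measure unitInterval)).map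
      (fun p : Ω × unitInterval => fun i : ι => if (p.2 : ℝ) * w (z i) ≤ w p.1 then p.1 else z i))
    (n : ℕ) (μ₀ : Measure (ι → Ω)) [IsProbabilityMeasure μ₀] {δ : ℝ} (hδ : 0 < δ)
    (hn : Real.log (1 / δ) ≤ n * (w x₀)⁻¹) :
    1 - δ ≤ ((fun m : Measure (ι → Ω) => m.bind Khat)^[n] μ₀).real {z | ∀ i j, z i = z j} := by
  have h := iterate_bind_crnFamily_allEqual_ge hw hw0 hmax Khat hK n μ₀
  have hW : 1 ≤ w x₀ := one_le_of_mode (q := q) hmax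
  have hr0 : 0 ≤ 1 - (w x₀)⁻¹ := sub_nonneg.2 (inv_le_one_of_one_le₀ hW)
  have hrn : (1 - (w x₀)⁻¹) ^ n ≤ δ := by
    calc (1 - (w x₀)⁻¹) ^ n ≤ Real.exp (-(w x₀)⁻¹) ^ n := by
          gcongr
          have := Real.add_one_le_exp (-(w x₀)⁻¹)
          linarith
      _ = Real.exp (-(n * (w x₀)⁻¹)) := by rw [← Real.exp_nat_mul]; ring_nf
      _ ≤ Real.exp (-Real.log (1 / δ)) := Real.exp_le_exp.2 (neg_le_neg hn)
      _ = δ := by rw [Real.exp_neg, Real.exp_log (by positivity), one_div, inv_inv]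
  linarith

/-- **EVERY OBSERVABLE READS THE SAME ON ALL RUNS OF A COUNTABLE FAMILY** (diagonal-free, any measurable space): for a
measurable `g : Ω → ℝ`, `P(g(Z_n i) = g(Z_n j) for all i, j) ≥ 1 − rⁿ`. [ours] -/
theorem iterate_bind_crnFamily_observable_allEqual_ge [Countable ι] (hw : Measurable w) (hw0 : ∀ y, 0 < w y)
    {x₀ : Ω} (hmax : ∀ y, w y ≤ w x₀) [IsProbabilityMeasure (q.withDensity fun y => ENNReal.ofReal (w y))]
    (Khat : Kernel (ι → Ω) (ι → Ω)) [IsMarkovKernel Khat]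
    (hK : ∀ z : ι → Ω, Khat z = (q.prod (volume : Measure unitInterval)).map
      (fun p : Ω × unitInterval => fun i : ι => if (p.2 : ℝ) * w (z i) ≤ w p.1 then p.1 else z i))
    (n : ℕ) (μ₀ : Measure (ι → Ω)) [IsProbabilityMeasure μ₀] {g : Ω → ℝ} (hg : Measurable g) :
    1 - (1 - (w x₀)⁻¹) ^ n ≤
      ((fun m : Measure (ι → Ω) => m.bind Khat)^[n] μ₀).real {z | ∀ i j, g (z i) = g (z j)} := by
  have hC : MeasurableSet {z : ι → Ω | ∀ i j, g (z i) = g (z j)} := by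
    have : {z : ι → Ω | ∀ i j, g (z i) = g (z j)} = ⋂ i, ⋂ j, {z : ι → Ω | g (z i) = g (z j)} := by
      ext z; simp
    rw [this]
    exact MeasurableSet.iInter fun i => MeasurableSet.iInter fun j =>
      measurableSet_eq_fun (hg.comp (measurable_pi_apply i)) (hg.comp (measurable_pi_apply j))
  have h := iterate_bind_crnFamily_real_ge hw hw0 hmax Khat hK n μ₀ hC
  have hset : {y : Ω | (fun _ : ι => y) ∈ {z : ι → Ω | ∀ i j, g (z i) = g (z j)}} = univ := by
    ext y; simp
  rwa [hset, probReal_univ, mul_one] at h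

end Summit.Ventures.LatticeQCDFlow.Exactness

end
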